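import Mathlib

/-!
# Stub `stub_cesaroTwoOfCesaroOne` (A2) of line `drude-controls-conductance` (R2) — crux
`JunctionLocality.NonBallistic` (stmt-AtomisticToContinuum-9127)

Helper file (`--supports stmt-AtomisticToContinuum-9127`); nothing here closes the item.

Pure real analysis (Mathlib only). For a measurable `g : ℝ → ℝ` with `|g s| ≤ B` on `s ≥ 0` whose
Cesàro mean tends to zero, `τ⁻¹ ∫₀^τ g → 0` (zero Drude weight), the second antiderivative
`V(t) = 2 ∫₀ᵗ (t - s) g(s) ds` satisfies `V(t) ≤ ε t²` at SOME time `t > 0`, for every `ε > 0`.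

Proof. With `G(u) := ∫₀ᵘ g`:
* (Fubini on the triangle `{0 < s ≤ u ≤ t}`) `∫₀ᵗ (t - s) g(s) ds = ∫₀ᵗ G(u) du` for `t ≥ 0`
  (`integral_sub_mul_eq_integral_primitive`);
* `|G(u)| ≤ max B 0 · u` for `u ≥ 0`, and, from the Cesàro hypothesis, `|G(u)| ≤ (ε/4) u` for `u ≥ u₀ > 0`;
* hence on `(0, t]`, `t ≥ u₀`, `|G| ≤ max B 0 · u₀ + (ε/4) t`, so
  `2 ∫₀ᵗ G ≤ 2 max B 0 · u₀ · t + (ε/2) t² ≤ ε t²` as soon as `ε t ≥ 4 max B 0 · u₀`; take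
  `t := u₀ (1 + 4 max B 0 / ε)`.
-/

namespace Summit.AtomisticToContinuum.FouriersLaw.Theorems.NonBallistic

open MeasureTheory Filter Topology

/-- Fubini on the triangle: for a measurable `g` bounded on `[0, ∞)` and `t ≥ 0`,
`∫₀ᵗ (t - s) g(s) ds = ∫₀ᵗ (∫₀ᵘ g(s) ds) du`. -/
private theorem integral_sub_mul_eq_integral_primitive {g : ℝ → ℝ} {B : ℝ} (hg : Measurable g)
    (hB : ∀ s : ℝ, 0 ≤ s → |g s| ≤ B) {t : ℝ} (ht : 0 ≤ t) :
    ∫ s in (0 : ℝ)..t, (t - s) * g s = ∫ u in (0 : ℝ)..t, ∫ s in (0 : ℝ)..u, g s := by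
  -- the integrand on the square `(0, t] × (0, t]`: `g s` on the triangle `0 ≤ s ≤ u`, else `0`
  set F : ℝ → ℝ → ℝ := fun s u => if 0 ≤ s ∧ s ≤ u then g s else 0 with hFdef
  have hmeas : Measurable (Function.uncurry F) := by
    show Measurable fun p : ℝ × ℝ => if 0 ≤ p.1 ∧ p.1 ≤ p.2 then g p.1 else 0
    exact Measurable.ite ((measurableSet_le measurable_const measurable_fst).inter
      (measurableSet_le measurable_fst measurable_snd)) (hg.comp measurable_fst) measurable_const
  have hbound : ∀ p : ℝ × ℝ, ‖Function.uncurry F p‖ ≤ max B 0 := by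
    rintro ⟨s, u⟩
    show ‖(if 0 ≤ s ∧ s ≤ u then g s else 0)‖ ≤ max B 0
    split_ifs with h
    · rw [Real.norm_eq_abs]
      exact (hB s h.1).trans (le_max_left B 0)
    · simp
  have hint : Integrable (Function.uncurry F)
      ((volume.restrict (Set.Ioc (0 : ℝ) t)).prod (volume.restrict (Set.Ioc (0 : ℝ) t))) :=
    (integrable_const (max B 0)).mono' hmeas.aestronglyMeasurable (Eventually.of_forall hbound)
  have hswap := MeasureTheory.integral_integral_swap hint
  -- inner integral in `u` at fixed `s ∈ (0, t]`: `(t - s) g(s)`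
  have h1 : Set.EqOn (fun s => ∫ u in Set.Ioc (0 : ℝ) t, F s u) (fun s => (t - s) * g s)
      (Set.Ioc (0 : ℝ) t) := by
    intro s hs
    have hF : F s = (Set.Ici s).indicator fun _ => g s := by
      funext u
      by_cases h : s ≤ u
      · simp [hFdef, h, hs.1.le]
      · simp [hFdef, h]
    have hset : Set.Ici s ∩ Set.Ioc (0 : ℝ) t = Set.Icc s t := by
      ext u
      simp only [Set.mem_inter_iff, Set.mem_Ici, Set.mem_Ioc, Set.mem_Icc]
      exact ⟨fun h => ⟨h.1, h.2.2⟩, fun h => ⟨h.1, hs.1.trans_le h.1, h.2⟩⟩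
    show ∫ u in Set.Ioc (0 : ℝ) t, F s u = (t - s) * g s
    rw [hF, integral_indicator measurableSet_Ici, Measure.restrict_restrict measurableSet_Ici, hset,
      setIntegral_const, Real.volume_real_Icc_of_le hs.2, smul_eq_mul]
  -- inner integral in `s` at fixed `u ∈ (0, t]`: `G(u) = ∫₀ᵘ g`
  have h2 : Set.EqOn (fun u => ∫ s in Set.Ioc (0 : ℝ) t, F s u) (fun u => ∫ s in (0 : ℝ)..u, g s)
      (Set.Ioc (0 : ℝ) t) := by
    intro u hu
    have hF : (fun s => F s u) = (Set.Icc 0 u).indicator g := by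
      funext s
      simp [hFdef, Set.indicator, Set.mem_Icc]
    have hset : Set.Icc 0 u ∩ Set.Ioc (0 : ℝ) t = Set.Ioc 0 u := by
      ext s
      simp only [Set.mem_inter_iff, Set.mem_Icc, Set.mem_Ioc]
      exact ⟨fun h => ⟨h.2.1, h.1.2⟩, fun h => ⟨⟨h.1.le, h.2⟩, h.1, h.2.trans hu.2⟩⟩
    show ∫ s in Set.Ioc (0 : ℝ) t, F s u = ∫ s in (0 : ℝ)..u, g s
    rw [hF, integral_indicator measurableSet_Icc, Measure.restrict_restrict measurableSet_Icc, hset,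
      intervalIntegral.integral_of_le hu.1.le]
  calc ∫ s in (0 : ℝ)..t, (t - s) * g s
      = ∫ s in Set.Ioc (0 : ℝ) t, (t - s) * g s := intervalIntegral.integral_of_le ht
    _ = ∫ s in Set.Ioc (0 : ℝ) t, ∫ u in Set.Ioc (0 : ℝ) t, F s u :=
        (setIntegral_congr_fun measurableSet_Ioc h1).symm
    _ = ∫ u in Set.Ioc (0 : ℝ) t, ∫ s in Set.Ioc (0 : ℝ) t, F s u := hswap
    _ = ∫ u in Set.Ioc (0 : ℝ) t, ∫ s in (0 : ℝ)..u, g s := setIntegral_congr_fun measurableSet_Ioc h2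
    _ = ∫ u in (0 : ℝ)..t, ∫ s in (0 : ℝ)..u, g s := (intervalIntegral.integral_of_le ht).symm

/-- **Stub `stub_cesaroTwoOfCesaroOne`** (A2, registered stub of line `drude-controls-conductance`, R2;
pure real analysis): if `g` is measurable, `|g s| ≤ B` for `s ≥ 0`, and the Cesàro mean
`τ⁻¹ ∫₀^τ g` tends to `0` (zero Drude weight), then for every `ε > 0` there is a time `t > 0` with
`2 ∫₀ᵗ (t - s) g(s) ds ≤ ε t²`. -/
theorem stub_cesaroTwoOfCesaroOne :
    ∀ (g : ℝ → ℝ) (B : ℝ), Measurable g → (∀ s : ℝ, 0 ≤ s → |g s| ≤ B) →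
      Tendsto (fun τ : ℝ => τ⁻¹ * ∫ t in (0:ℝ)..τ, g t) atTop (𝓝 0) →
      ∀ ε : ℝ, 0 < ε → ∃ t : ℝ, 0 < t ∧ (2 * ∫ s in (0 : ℝ)..t, (t - s) * g s) ≤ ε * t ^ 2 := by
  intro g B hg hB hces ε hε
  set M : ℝ := max B 0 with hMdef
  have hM0 : 0 ≤ M := le_max_right B 0
  -- `|G u| ≤ M u` for `u ≥ 0`
  have hGM : ∀ u : ℝ, 0 ≤ u → |∫ s in (0 : ℝ)..u, g s| ≤ M * u := by
    intro u hu
    have h := intervalIntegral.norm_integral_le_of_norm_le_const (a := 0) (b := u) (C := M)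
      (f := g) (fun x hx => by
        rw [Set.uIoc_of_le hu] at hx
        rw [Real.norm_eq_abs]
        exact (hB x hx.1.le).trans (le_max_left B 0))
    rwa [Real.norm_eq_abs, sub_zero, abs_of_nonneg hu] at h
  -- from the Cesàro hypothesis: `|G u| ≤ (ε/4) u` for `u ≥ u₀ > 0`
  obtain ⟨N, hN⟩ := (Metric.tendsto_atTop.mp hces) (ε / 4) (by positivity)
  set u₀ : ℝ := max N 1 with hu₀def
  have hu₀pos : 0 < u₀ := lt_of_lt_of_le one_pos (le_max_right N 1)
  have hGε : ∀ u : ℝ, u₀ ≤ u → |∫ s in (0 : ℝ)..u, g s| ≤ ε / 4 * u := by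
    intro u hu
    have hupos : 0 < u := hu₀pos.trans_le hu
    have h := hN u ((le_max_left N 1).trans hu)
    rw [Real.dist_eq, sub_zero, abs_mul, abs_inv, abs_of_pos hupos, inv_mul_lt_iff₀ hupos] at h
    linarith
  -- the time `t := u₀ (1 + 4 M / ε) ≥ u₀`
  set t : ℝ := u₀ * (1 + 4 * M / ε) with htdef
  have hc : 1 ≤ 1 + 4 * M / ε := le_add_of_nonneg_right (by positivity)
  have htu₀ : u₀ ≤ t := le_mul_of_one_le_right hu₀pos.le hc
  have htpos : 0 < t := hu₀pos.trans_le htu₀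
  have hεt : ε * t = ε * u₀ + 4 * M * u₀ := by
    rw [htdef]
    field_simp
  refine ⟨t, htpos, ?_⟩
  -- on `(0, t]`: `|G| ≤ M u₀ + (ε/4) t`
  have hGt : ∀ x ∈ Set.uIoc (0 : ℝ) t, ‖∫ s in (0 : ℝ)..x, g s‖ ≤ M * u₀ + ε / 4 * t := by
    intro x hx
    rw [Set.uIoc_of_le htpos.le] at hx
    rw [Real.norm_eq_abs]
    rcases le_or_gt x u₀ with hxu | hxu
    · calc |∫ s in (0 : ℝ)..x, g s| ≤ M * x := hGM x hx.1.le
        _ ≤ M * u₀ := mul_le_mul_of_nonneg_left hxu hM0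
        _ ≤ M * u₀ + ε / 4 * t := le_add_of_nonneg_right (by positivity)
    · calc |∫ s in (0 : ℝ)..x, g s| ≤ ε / 4 * x := hGε x hxu.le
        _ ≤ ε / 4 * t := mul_le_mul_of_nonneg_left hx.2 (by positivity)
        _ ≤ M * u₀ + ε / 4 * t := le_add_of_nonneg_left (by positivity)
  have hI := intervalIntegral.norm_integral_le_of_norm_le_const hGt
  rw [Real.norm_eq_abs, sub_zero, abs_of_pos htpos] at hI
  rw [integral_sub_mul_eq_integral_primitive hg hB htpos.le]
  have hle := (le_abs_self (∫ u in (0 : ℝ)..t, ∫ s in (0 : ℝ)..u, g s)).trans hI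
  have hkey : 4 * M * u₀ * t ≤ ε * t * t := by
    rw [hεt]
    nlinarith [mul_nonneg (mul_nonneg hε.le hu₀pos.le) htpos.le]
  nlinarith [hle, hkey]

end Summit.AtomisticToContinuum.FouriersLaw.Theorems.NonBallistic
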